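import Literature.NumberTheory.Transcendental.BoxIntegralZetaValues
import Literature.NumberTheory.Transcendental.BoxIntegralLTwoChiThree
import Literature.NumberTheory.Transcendental.CalegariDimitrovTangL2Chi3Trigamma
import HarnessLib

/-!
# Weight-`2` Hurwitz box integrals: `∫_{(0,1)²} (x₀x₁)ʳ dx/(1 − (x₀x₁)ᵐ) = Σ_k (mk+r+1)⁻²`, the
level-`6` values `H₀,…,H₅ ∈ ℚL(2,χ₋₃) + ℚπ²`, and the normal-form integral `a + bπ²/6 + cL(2,χ₋₃)`

Sequel of `BoxIntegralZetaValues.lean` (`∫_{(0,1)²} dx/(1−x₀x₁) = π²/6`) and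
`BoxIntegralLTwoChiThree.lean` (`∫_{(0,1)²} dx/(1+x₀x₁+(x₀x₁)²) = L2chi3`), in the same literal
shape `∫ x in {x : Fin 2 → ℝ | ∀ i, x i ∈ Ioo 0 1}, …` of the tree's Kontsevich–Zagier calculus.
The weight-`2`, level-`m` "box sector" of that calculus consists of the integrands
`P(x₀x₁)/(1 − (x₀x₁)ᵐ)`; its values are spanned by the Hurwitz numbers
`H_r := ∫_{(0,1)²} (x₀x₁)ʳ/(1 − (x₀x₁)ᵐ) = Σ_{k≥0} (mk+r+1)⁻² = m⁻² ζ(2, (r+1)/m)` (`0 ≤ r < m`).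
Route HurwitzMicroSectors of summit KontsevichZagierPeriods works at level `m = 6`, where
`H₀,…,H₅ ∈ ℚ L(2,χ₋₃) + ℚ π²` and four distribution relations hold ("H2=3H5, H0+H3=4H1,
H0+H2+H4=9H2, H1+H3+H5=9H5"; "all relations verified numerically to 1e−14" there), and its
normal forms are `a + b/(1−xy) + c/(1+xy+x²y²)` with value `a + bπ²/6 + cL(2,χ₋₃)`.

This file PROVES:

* `BoxIntegral.box_integral_pow_div_one_sub_pow` (`integrableOn_…`, `setIntegral_…`) — for
  `m ≥ 1`, `r ≥ 0`: `(x₀x₁)ʳ/(1 − (x₀x₁)ᵐ)` is integrable on the open box (dominated by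
  `1/(1−x₀x₁)`) and **`∫ = Σ_{k≥0} 1/(mk+r+1)²`** (geometric expansion, term-wise integration);
* `BoxIntegral.setIntegral_box_level_six_zero` … `_five` — the exact values
  `H₀ = 5L/8 + π²/18`, `H₁ = L/8 + π²/54`, `H₂ = π²/72`, `H₃ = −L/8 + π²/54`,
  `H₄ = −5L/8 + π²/18`, `H₅ = π²/216` (`L = L2chi3`; from the mod-`6` series of
  `…L2Chi3ModSix.lean` / `…L2Chi3Trigamma.lean`), and `BoxIntegral.level_six_relations` — the four
  distribution relations as exact identities;
* `BoxIntegral.setIntegral_box_normalForm`, `integrableOn_box_normalForm` —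
  **`∫_{(0,1)²} (a + b/(1−x₀x₁) + c/(1+x₀x₁+(x₀x₁)²)) dx = a + b·π²/6 + c·L2chi3`** (the box has
  volume `1`: `volume_box`, `setIntegral_box_const`), and `BoxIntegral.normalForm_coeff_eq` — under
  CDT's Theorem 1 (the named fact `calegariDimitrovTang_linearIndependent` as hypothesis) equal
  values of two rational normal forms force equal coefficients.

No named facts (D-0026); apart from `normalForm_coeff_eq` (which takes the CDT fact as an explicit
hypothesis) everything is unconditional.

## References

* [CalegariDimitrovTang2024] F. Calegari, V. Dimitrov, Y. Tang, arXiv:2408.15403, Thm. 1 and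
  Cor. 2 (p. 3) (the mod-`3`/mod-`6` values of `ζ(2, ·)` in terms of `L(2,χ₋₃)` and `π²`).
* [KontsevichZagier2001] M. Kontsevich, D. Zagier, *Periods* (2001), §1.1.
-/

noncomputable section

open MeasureTheory Set Filter Real Finset

namespace Literature.NumberTheory.Transcendental

namespace BoxIntegral

/-! ### The open unit box of `Fin 2 → ℝ`: the product coordinate and the volume -/

/-- On the open unit box of `Fin 2 → ℝ`, `x₀x₁ ∈ (0,1)`. [folklore] -/
theorem mul_mem_Ioo_of_mem_box {x : Fin 2 → ℝ} (hx : ∀ i, x i ∈ Ioo (0 : ℝ) 1) :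
    x 0 * x 1 ∈ Ioo (0 : ℝ) 1 :=
  ⟨mul_pos (hx 0).1 (hx 1).1, mul_lt_one_of_nonneg_of_lt_one_left (hx 0).1.le (hx 0).2 (hx 1).2.le⟩

/-- The open unit box of `Fin n → ℝ` has Lebesgue measure `1`. [folklore] -/
theorem volume_box (n : ℕ) : volume {x : Fin n → ℝ | ∀ i, x i ∈ Ioo (0 : ℝ) 1} = 1 := by
  rw [Beukers.setOf_forall_mem_Ioo_eq_pi, volume_pi_pi]
  simp

/-- `∫_{(0,1)ⁿ} a dx = a`. [folklore] -/
theorem setIntegral_box_const (n : ℕ) (a : ℝ) :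
    ∫ _x in {x : Fin n → ℝ | ∀ i, x i ∈ Ioo (0 : ℝ) 1}, a = a := by
  rw [setIntegral_const, measureReal_def, volume_box, ENNReal.toReal_one, one_smul]

/-- Constants are integrable on the open unit box. [folklore] -/
theorem integrableOn_box_const (n : ℕ) (a : ℝ) :
    IntegrableOn (fun _ : Fin n → ℝ => a) {x | ∀ i, x i ∈ Ioo (0 : ℝ) 1} volume :=
  integrableOn_const (by rw [volume_box]; exact ENNReal.one_ne_top)

/-- `∫_{(0,1)²} (x₀x₁)ᵏ dx = 1/(k+1)²` (coordinate form of `setIntegral_box_prod_pow`). [folklore] -/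
theorem setIntegral_box_mul_pow (k : ℕ) :
    ∫ x in {x : Fin 2 → ℝ | ∀ i, x i ∈ Ioo (0 : ℝ) 1}, (x 0 * x 1) ^ k = 1 / ((k : ℝ) + 1) ^ 2 := by
  have h := setIntegral_box_prod_pow 2 k
  simp only [Fin.prod_univ_two] at h
  rw [h, one_div_pow]

/-- `(x₀x₁)ᵏ` is integrable on the open unit box (coordinate form). [folklore] -/
theorem integrableOn_box_mul_pow (k : ℕ) :
    IntegrableOn (fun x : Fin 2 → ℝ => (x 0 * x 1) ^ k) {x | ∀ i, x i ∈ Ioo (0 : ℝ) 1} volume := by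
  have h := integrableOn_box_prod_pow 2 k
  simp only [Fin.prod_univ_two] at h
  exact h

/-! ### The kernel `tʳ/(1 − tᵐ)`: bound and geometric expansion -/

/-- For `0 ≤ t < 1`, `m ≥ 1`: `tʳ/(1 − tᵐ) ≤ 1/(1 − t)` (numerator `≤ 1`, denominator
`1 − tᵐ ≥ 1 − t`). [folklore] -/
theorem pow_div_one_sub_pow_le {t : ℝ} (ht0 : 0 ≤ t) (ht1 : t < 1) {m : ℕ} (hm : 1 ≤ m) (r : ℕ) :
    t ^ r / (1 - t ^ m) ≤ 1 / (1 - t) := by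
  have htm : t ^ m ≤ t := pow_le_of_le_one ht0 ht1.le (by omega)
  exact div_le_div₀ zero_le_one (pow_le_one₀ ht0 ht1.le) (by linarith) (by linarith)

/-- For `0 ≤ t < 1`, `m ≥ 1`: `tʳ/(1 − tᵐ) = Σ_{k≥0} t^{mk+r}`. [folklore] -/
theorem hasSum_pow_mul_add {t : ℝ} (ht0 : 0 ≤ t) (ht1 : t < 1) {m : ℕ} (hm : 1 ≤ m) (r : ℕ) :
    HasSum (fun k : ℕ => t ^ (m * k + r)) (t ^ r / (1 - t ^ m)) := by
  have hg := (hasSum_geometric_of_lt_one (pow_nonneg ht0 m)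
    (pow_lt_one₀ ht0 ht1 (by omega))).mul_left (t ^ r)
  rw [div_eq_mul_inv]
  refine hg.congr_fun fun k => ?_
  rw [pow_add, pow_mul, mul_comm]

/-! ### The Hurwitz box integral -/

/-- **`(x₀x₁)ʳ/(1 − (x₀x₁)ᵐ)` is integrable on the open unit box** (`m ≥ 1`; dominated by
`1/(1 − x₀x₁)`, `box_integral_one_div_one_sub_mul_two`). [folklore] -/
theorem integrableOn_box_pow_div_one_sub_pow {m : ℕ} (hm : 1 ≤ m) (r : ℕ) :
    IntegrableOn (fun x : Fin 2 → ℝ => (x 0 * x 1) ^ r / (1 - (x 0 * x 1) ^ m))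
      {x | ∀ i, x i ∈ Ioo (0 : ℝ) 1} volume := by
  refine Integrable.mono' box_integral_one_div_one_sub_mul_two.1
    ((by fun_prop : Measurable fun x : Fin 2 → ℝ =>
      (x 0 * x 1) ^ r / (1 - (x 0 * x 1) ^ m)).aestronglyMeasurable) ?_
  refine ae_restrict_of_forall_mem (Beukers.measurableSet_cube 2) fun x hx => ?_
  have ht := mul_mem_Ioo_of_mem_box hx
  have hden : 0 < 1 - (x 0 * x 1) ^ m := by
    have : (x 0 * x 1) ^ m < 1 := pow_lt_one₀ ht.1.le ht.2 (by omega)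
    linarith
  rw [Real.norm_eq_abs, abs_of_nonneg (div_nonneg (pow_nonneg ht.1.le r) hden.le)]
  exact pow_div_one_sub_pow_le ht.1.le ht.2 hm r

/-- `Σ_k 1/(mk+r+1)²` converges (`m ≥ 1`: compare with `Σ 1/(k+1)²`). [folklore] -/
theorem summable_one_div_mul_add_sq {m : ℕ} (hm : 1 ≤ m) (r : ℕ) :
    Summable fun k : ℕ => 1 / ((m : ℝ) * k + r + 1) ^ 2 := by
  have h2 := summable_one_div_succ_pow' (n := 2) le_rfl
  refine h2.of_nonneg_of_le (fun k => by positivity) fun k => ?_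
  rw [one_div_pow]
  have hm' : (1 : ℝ) ≤ m := by exact_mod_cast hm
  have hk : (0 : ℝ) ≤ k := k.cast_nonneg
  have hr : (0 : ℝ) ≤ r := r.cast_nonneg
  apply one_div_le_one_div_of_le (by positivity)
  nlinarith [mul_le_mul_of_nonneg_right hm' hk]

/-- **The weight-`2` Hurwitz box integral**: for `m ≥ 1` and `r ≥ 0`,
`∫_{(0,1)²} (x₀x₁)ʳ dx/(1 − (x₀x₁)ᵐ) = Σ_{k≥0} 1/(mk+r+1)²` (`= m⁻² ζ(2, (r+1)/m)`): expand
`tʳ/(1−tᵐ) = Σ t^{mk+r}` and integrate term-wise (`∫ (x₀x₁)ʲ = (j+1)⁻²`). These are the numbers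
`H_r` of the level-`m` sector `P(xy)/(1−(xy)ᵐ)` of the Kontsevich–Zagier calculus on the box.
[folklore] -/
theorem setIntegral_box_pow_div_one_sub_pow {m : ℕ} (hm : 1 ≤ m) (r : ℕ) :
    ∫ x in {x : Fin 2 → ℝ | ∀ i, x i ∈ Ioo (0 : ℝ) 1}, (x 0 * x 1) ^ r / (1 - (x 0 * x 1) ^ m)
      = ∑' k : ℕ, 1 / ((m : ℝ) * k + r + 1) ^ 2 := by
  -- term-wise integrals
  have hval : ∀ k : ℕ, ∫ x in {x : Fin 2 → ℝ | ∀ i, x i ∈ Ioo (0 : ℝ) 1}, (x 0 * x 1) ^ (m * k + r)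
      = 1 / ((m : ℝ) * k + r + 1) ^ 2 := by
    intro k
    rw [setIntegral_box_mul_pow]
    push_cast
    ring_nf
  have hnorm : ∀ k : ℕ, ∫ x in {x : Fin 2 → ℝ | ∀ i, x i ∈ Ioo (0 : ℝ) 1}, ‖(x 0 * x 1) ^ (m * k + r)‖
      = 1 / ((m : ℝ) * k + r + 1) ^ 2 := by
    intro k
    rw [← hval k]
    exact setIntegral_congr_fun (Beukers.measurableSet_cube 2) fun x hx =>
      Real.norm_of_nonneg (pow_nonneg (mul_mem_Ioo_of_mem_box hx).1.le _)
  have hsum : Summable fun k : ℕ =>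
      ∫ x in {x : Fin 2 → ℝ | ∀ i, x i ∈ Ioo (0 : ℝ) 1}, ‖(x 0 * x 1) ^ (m * k + r)‖ := by
    simp_rw [hnorm]
    exact summable_one_div_mul_add_sq hm r
  have h := hasSum_integral_of_summable_integral_norm
    (μ := volume.restrict {x : Fin 2 → ℝ | ∀ i, x i ∈ Ioo (0 : ℝ) 1})
    (F := fun (k : ℕ) (x : Fin 2 → ℝ) => (x 0 * x 1) ^ (m * k + r))
    (fun k => integrableOn_box_mul_pow _) hsum
  simp only [hval] at h
  rw [h.tsum_eq]
  refine setIntegral_congr_fun (Beukers.measurableSet_cube 2) fun x hx => ?_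
  have ht := mul_mem_Ioo_of_mem_box hx
  exact ((hasSum_pow_mul_add ht.1.le ht.2 hm r).tsum_eq).symm

/-- **Hurwitz box integral, conjunction form** (integrability and value). [folklore] -/
theorem box_integral_pow_div_one_sub_pow {m : ℕ} (hm : 1 ≤ m) (r : ℕ) :
    IntegrableOn (fun x : Fin 2 → ℝ => (x 0 * x 1) ^ r / (1 - (x 0 * x 1) ^ m))
        {x | ∀ i, x i ∈ Ioo (0 : ℝ) 1} volume ∧
      ∫ x in {x : Fin 2 → ℝ | ∀ i, x i ∈ Ioo (0 : ℝ) 1}, (x 0 * x 1) ^ r / (1 - (x 0 * x 1) ^ m)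
        = ∑' k : ℕ, 1 / ((m : ℝ) * k + r + 1) ^ 2 :=
  ⟨integrableOn_box_pow_div_one_sub_pow hm r, setIntegral_box_pow_div_one_sub_pow hm r⟩

/-! ### Level `6`: the six numbers `H_r = ∫_{(0,1)²} (x₀x₁)ʳ dx/(1 − (x₀x₁)⁶)` -/

/-- `H₀ = Σ 1/(6k+1)² = 5L(2,χ₋₃)/8 + π²/18`. [folklore] -/
theorem setIntegral_box_level_six_zero :
    ∫ x in {x : Fin 2 → ℝ | ∀ i, x i ∈ Ioo (0 : ℝ) 1}, (x 0 * x 1) ^ 0 / (1 - (x 0 * x 1) ^ 6)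
      = 5 * L2chi3 / 8 + Real.pi ^ 2 / 18 := by
  rw [setIntegral_box_pow_div_one_sub_pow (by norm_num) 0, ← tsum_one_div_six_mul_add_one_sq]
  refine tsum_congr fun k => ?_
  push_cast
  ring_nf

/-- `H₁ = Σ 1/(6k+2)² = L(2,χ₋₃)/8 + π²/54`. [folklore] -/
theorem setIntegral_box_level_six_one :
    ∫ x in {x : Fin 2 → ℝ | ∀ i, x i ∈ Ioo (0 : ℝ) 1}, (x 0 * x 1) ^ 1 / (1 - (x 0 * x 1) ^ 6)
      = L2chi3 / 8 + Real.pi ^ 2 / 54 := by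
  rw [setIntegral_box_pow_div_one_sub_pow (by norm_num) 1, ← tsum_one_div_six_mul_add_two_sq]
  refine tsum_congr fun k => ?_
  push_cast
  ring_nf

/-- `H₂ = Σ 1/(6k+3)² = π²/72`. [folklore] -/
theorem setIntegral_box_level_six_two :
    ∫ x in {x : Fin 2 → ℝ | ∀ i, x i ∈ Ioo (0 : ℝ) 1}, (x 0 * x 1) ^ 2 / (1 - (x 0 * x 1) ^ 6)
      = Real.pi ^ 2 / 72 := by
  rw [setIntegral_box_pow_div_one_sub_pow (by norm_num) 2, ← tsum_one_div_six_mul_add_three_sq]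
  refine tsum_congr fun k => ?_
  push_cast
  ring_nf

/-- `H₃ = Σ 1/(6k+4)² = −L(2,χ₋₃)/8 + π²/54`. [folklore] -/
theorem setIntegral_box_level_six_three :
    ∫ x in {x : Fin 2 → ℝ | ∀ i, x i ∈ Ioo (0 : ℝ) 1}, (x 0 * x 1) ^ 3 / (1 - (x 0 * x 1) ^ 6)
      = -(L2chi3 / 8) + Real.pi ^ 2 / 54 := by
  rw [setIntegral_box_pow_div_one_sub_pow (by norm_num) 3, ← tsum_one_div_six_mul_add_four_sq]
  refine tsum_congr fun k => ?_
  push_cast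
  ring_nf

/-- `H₄ = Σ 1/(6k+5)² = −5L(2,χ₋₃)/8 + π²/18`. [folklore] -/
theorem setIntegral_box_level_six_four :
    ∫ x in {x : Fin 2 → ℝ | ∀ i, x i ∈ Ioo (0 : ℝ) 1}, (x 0 * x 1) ^ 4 / (1 - (x 0 * x 1) ^ 6)
      = -(5 * L2chi3 / 8) + Real.pi ^ 2 / 18 := by
  rw [setIntegral_box_pow_div_one_sub_pow (by norm_num) 4, ← tsum_one_div_six_mul_add_five_sq]
  refine tsum_congr fun k => ?_
  push_cast
  ring_nf

/-- `H₅ = Σ 1/(6k+6)² = π²/216`. [folklore] -/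
theorem setIntegral_box_level_six_five :
    ∫ x in {x : Fin 2 → ℝ | ∀ i, x i ∈ Ioo (0 : ℝ) 1}, (x 0 * x 1) ^ 5 / (1 - (x 0 * x 1) ^ 6)
      = Real.pi ^ 2 / 216 := by
  rw [setIntegral_box_pow_div_one_sub_pow (by norm_num) 5, ← tsum_one_div_six_mul_add_six_sq]
  refine tsum_congr fun k => ?_
  push_cast
  ring_nf

/-- **The four level-`6` distribution relations** among `H₀,…,H₅` (in the notation of route
HurwitzMicroSectors: `H₂ = 3H₅`, `H₀ + H₃ = 4H₁`, `H₀ + H₂ + H₄ = 9H₂`, `H₁ + H₃ + H₅ = 9H₅`; they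
are the `m = 2` and `m = 3` dilation/distribution relations of the Hurwitz values), as exact
identities of the box integrals. [folklore] -/
theorem level_six_relations :
    (∫ x in {x : Fin 2 → ℝ | ∀ i, x i ∈ Ioo (0 : ℝ) 1}, (x 0 * x 1) ^ 2 / (1 - (x 0 * x 1) ^ 6))
        = 3 * ∫ x in {x : Fin 2 → ℝ | ∀ i, x i ∈ Ioo (0 : ℝ) 1}, (x 0 * x 1) ^ 5 / (1 - (x 0 * x 1) ^ 6) ∧
    (∫ x in {x : Fin 2 → ℝ | ∀ i, x i ∈ Ioo (0 : ℝ) 1}, (x 0 * x 1) ^ 0 / (1 - (x 0 * x 1) ^ 6))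
        + (∫ x in {x : Fin 2 → ℝ | ∀ i, x i ∈ Ioo (0 : ℝ) 1}, (x 0 * x 1) ^ 3 / (1 - (x 0 * x 1) ^ 6))
        = 4 * ∫ x in {x : Fin 2 → ℝ | ∀ i, x i ∈ Ioo (0 : ℝ) 1}, (x 0 * x 1) ^ 1 / (1 - (x 0 * x 1) ^ 6) ∧
    (∫ x in {x : Fin 2 → ℝ | ∀ i, x i ∈ Ioo (0 : ℝ) 1}, (x 0 * x 1) ^ 0 / (1 - (x 0 * x 1) ^ 6))
        + (∫ x in {x : Fin 2 → ℝ | ∀ i, x i ∈ Ioo (0 : ℝ) 1}, (x 0 * x 1) ^ 2 / (1 - (x 0 * x 1) ^ 6))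
        + (∫ x in {x : Fin 2 → ℝ | ∀ i, x i ∈ Ioo (0 : ℝ) 1}, (x 0 * x 1) ^ 4 / (1 - (x 0 * x 1) ^ 6))
        = 9 * ∫ x in {x : Fin 2 → ℝ | ∀ i, x i ∈ Ioo (0 : ℝ) 1}, (x 0 * x 1) ^ 2 / (1 - (x 0 * x 1) ^ 6) ∧
    (∫ x in {x : Fin 2 → ℝ | ∀ i, x i ∈ Ioo (0 : ℝ) 1}, (x 0 * x 1) ^ 1 / (1 - (x 0 * x 1) ^ 6))
        + (∫ x in {x : Fin 2 → ℝ | ∀ i, x i ∈ Ioo (0 : ℝ) 1}, (x 0 * x 1) ^ 3 / (1 - (x 0 * x 1) ^ 6))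
        + (∫ x in {x : Fin 2 → ℝ | ∀ i, x i ∈ Ioo (0 : ℝ) 1}, (x 0 * x 1) ^ 5 / (1 - (x 0 * x 1) ^ 6))
        = 9 * ∫ x in {x : Fin 2 → ℝ | ∀ i, x i ∈ Ioo (0 : ℝ) 1}, (x 0 * x 1) ^ 5 / (1 - (x 0 * x 1) ^ 6) := by
  rw [setIntegral_box_level_six_zero, setIntegral_box_level_six_one, setIntegral_box_level_six_two,
    setIntegral_box_level_six_three, setIntegral_box_level_six_four, setIntegral_box_level_six_five]
  refine ⟨by ring, by ring, by ring, by ring⟩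

/-! ### The normal-form integrand `a + b/(1 − x₀x₁) + c/(1 + x₀x₁ + (x₀x₁)²)` -/

/-- The normal-form integrand is integrable on the open unit box. [folklore] -/
theorem integrableOn_box_normalForm (a b c : ℝ) :
    IntegrableOn (fun x : Fin 2 → ℝ =>
        a + b / (1 - x 0 * x 1) + c / (1 + x 0 * x 1 + (x 0 * x 1) ^ 2))
      {x | ∀ i, x i ∈ Ioo (0 : ℝ) 1} volume := by
  have h1 := box_integral_one_div_one_sub_mul_two.1
  have h2 := box_integral_L_two_chi_three.1
  have hb : IntegrableOn (fun x : Fin 2 → ℝ => b / (1 - x 0 * x 1)) {x | ∀ i, x i ∈ Ioo (0 : ℝ) 1} volume := by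
    have hb' : IntegrableOn (fun x : Fin 2 → ℝ => b * (1 / (1 - x 0 * x 1)))
        {x | ∀ i, x i ∈ Ioo (0 : ℝ) 1} volume := h1.const_mul b
    refine IntegrableOn.congr_fun hb' (fun x _ => ?_) (Beukers.measurableSet_cube 2)
    simp only [mul_one_div]
  have hc : IntegrableOn (fun x : Fin 2 → ℝ => c / (1 + x 0 * x 1 + (x 0 * x 1) ^ 2))
      {x | ∀ i, x i ∈ Ioo (0 : ℝ) 1} volume := by
    have hc' : IntegrableOn (fun x : Fin 2 → ℝ => c * (1 / (1 + x 0 * x 1 + (x 0 * x 1) ^ 2)))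
        {x | ∀ i, x i ∈ Ioo (0 : ℝ) 1} volume := h2.const_mul c
    refine IntegrableOn.congr_fun hc' (fun x _ => ?_) (Beukers.measurableSet_cube 2)
    simp only [mul_one_div]
  have hab : IntegrableOn (fun x : Fin 2 → ℝ => a + b / (1 - x 0 * x 1))
      {x | ∀ i, x i ∈ Ioo (0 : ℝ) 1} volume := (integrableOn_box_const 2 a).add hb
  exact hab.add hc

/-- **The normal-form integral**:
`∫_{(0,1)²} (a + b/(1 − x₀x₁) + c/(1 + x₀x₁ + (x₀x₁)²)) dx = a + b·π²/6 + c·L(2,χ₋₃)`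
(the box has volume `1`; `box_integral_one_div_one_sub_mul_two`, `box_integral_L_two_chi_three`).
This is the value computation behind the rigidity item of route HurwitzMicroSectors (which then
compares coefficients using the linear independence of `1, π², L(2,χ₋₃)`).
[folklore] -/
theorem setIntegral_box_normalForm (a b c : ℝ) :
    ∫ x in {x : Fin 2 → ℝ | ∀ i, x i ∈ Ioo (0 : ℝ) 1},
        (a + b / (1 - x 0 * x 1) + c / (1 + x 0 * x 1 + (x 0 * x 1) ^ 2))
      = a + b * (Real.pi ^ 2 / 6) + c * L2chi3 := by
  have h1 := box_integral_one_div_one_sub_mul_two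
  have h2 := box_integral_L_two_chi_three
  have hb : IntegrableOn (fun x : Fin 2 → ℝ => b / (1 - x 0 * x 1)) {x | ∀ i, x i ∈ Ioo (0 : ℝ) 1} volume := by
    have hb' : IntegrableOn (fun x : Fin 2 → ℝ => b * (1 / (1 - x 0 * x 1)))
        {x | ∀ i, x i ∈ Ioo (0 : ℝ) 1} volume := h1.1.const_mul b
    refine IntegrableOn.congr_fun hb' (fun x _ => ?_) (Beukers.measurableSet_cube 2)
    simp only [mul_one_div]
  have hc : IntegrableOn (fun x : Fin 2 → ℝ => c / (1 + x 0 * x 1 + (x 0 * x 1) ^ 2))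
      {x | ∀ i, x i ∈ Ioo (0 : ℝ) 1} volume := by
    have hc' : IntegrableOn (fun x : Fin 2 → ℝ => c * (1 / (1 + x 0 * x 1 + (x 0 * x 1) ^ 2)))
        {x | ∀ i, x i ∈ Ioo (0 : ℝ) 1} volume := h2.1.const_mul c
    refine IntegrableOn.congr_fun hc' (fun x _ => ?_) (Beukers.measurableSet_cube 2)
    simp only [mul_one_div]
  have hab : IntegrableOn (fun x : Fin 2 → ℝ => a + b / (1 - x 0 * x 1))
      {x | ∀ i, x i ∈ Ioo (0 : ℝ) 1} volume := (integrableOn_box_const 2 a).add hb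
  rw [integral_add hab hc, integral_add (integrableOn_box_const 2 a) hb, setIntegral_box_const]
  have eb : ∫ x in {x : Fin 2 → ℝ | ∀ i, x i ∈ Ioo (0 : ℝ) 1}, b / (1 - x 0 * x 1)
      = b * (Real.pi ^ 2 / 6) := by
    rw [← h1.2, ← integral_const_mul]
    refine setIntegral_congr_fun (Beukers.measurableSet_cube 2) fun x _ => ?_
    rw [mul_one_div]
  have ec : ∫ x in {x : Fin 2 → ℝ | ∀ i, x i ∈ Ioo (0 : ℝ) 1}, c / (1 + x 0 * x 1 + (x 0 * x 1) ^ 2)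
      = c * L2chi3 := by
    rw [← setIntegral_box_kernel_chi3, ← integral_const_mul]
    refine setIntegral_congr_fun (Beukers.measurableSet_cube 2) fun x _ => ?_
    rw [mul_one_div]
  rw [eb, ec]

/-- **Rigidity of the normal form under CDT's Theorem 1**: if `1, π², L(2,χ₋₃)` are `ℚ`-linearly
independent (the named fact `calegariDimitrovTang_linearIndependent`), two normal-form integrals
with rational coefficients and equal values have equal coefficients. [cite: CalegariDimitrovTang2024, Thm. 1 (p. 3)] -/
theorem normalForm_coeff_eq (h : calegariDimitrovTang_linearIndependent) {a b c a' b' c' : ℚ}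
    (heq : (a : ℝ) + b * (Real.pi ^ 2 / 6) + c * L2chi3 = a' + b' * (Real.pi ^ 2 / 6) + c' * L2chi3) :
    a = a' ∧ b = b' ∧ c = c' := by
  have h0 := h.eq_zero (a - a') ((b - b') / 6) (c - c') (by push_cast; linarith)
  refine ⟨?_, ?_, ?_⟩
  · linarith [h0.1, show ((a - a' : ℚ) : ℝ) = a - a' by push_cast; ring]
  · have := h0.2.1
    have : b - b' = 0 := by linarith [show (b - b') / 6 * 6 = b - b' by ring]
    linarith
  · linarith [h0.2.2]

end BoxIntegral

end Literature.NumberTheory.Transcendental
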